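import Summits.BirchSwinnertonDyer.BirchSwinnertonDyer.Theorems.ByReductionTypeAtTwoOrdEisensteinHalfShaCrux
import Summits.BirchSwinnertonDyer.BirchSwinnertonDyer.Theorems.ByReductionTypeAtTwoOrdMissingLowerBoundDefs
import Summits.BirchSwinnertonDyer.BirchSwinnertonDyer.Theorems.ByReductionTypeAtTwoTowerLayerRank
import Summits.BirchSwinnertonDyer.BirchSwinnertonDyer.Theorems.ByReductionTypeAtTwoTowerClassKit
import HarnessLib

/-!
# The descent-inequality crux `OrdMissingLowerBoundAtTwo` (K-6, item stmt-BirchSwinnertonDyer-19577): its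
# place between the Eisenstein crux and the parent, and the per-curve roads that discharge it WITHOUT a
# descent certificate (route ByReductionTypeAtTwo; seat bsd-2adic-ord-3, GEN 4)

HONEST FRAMING (cell `bsd-2adic`, HUMAN RULINGS D-0036/D-0074): THEOREMS ONLY; REDUCTIONS and DOORS, not
closings — every non-PUB input is a displayed hypothesis; nothing asserted; no definition; no named fact.
BSD is not proved by any of this; a per-class close «closes rung K4 of BirchSwinnertonDyer», never summit credit.

WHAT IS PROVED.
* §1 (∀-level, the planner's K-6 bookkeeping, GEN 13 re-point (ii)): granted the support item
  `OrdPublishedInputsAtTwo` (PUB: modularity, GZK, Kato 17.4 (1)(2) AT `2`, Greenberg 4.1 parity-free),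
  the Eisenstein crux `Theorems.OrdHalvesAtTwo.OrdEisensteinHalfAtTwo` (item 19272, HELD) IMPLIES the
  descent crux `Theorems.OrdHalvesAtTwo.OrdMissingLowerBoundAtTwo` (item 19577) —
  `ordMissingLowerBoundAtTwo_of_ordEisensteinHalfAtTwo` — so K-6 is a WEAKENING of the binder it replaced;
  and the descent crux is NECESSARY for the parent: the rank-`0` formula `∀ …, BSDp W 2` gives it back
  (`ordMissingLowerBoundAtTwo_of_forall_bsdp`, GZK for the finiteness of `Ш`).
* §2 (per curve): `MissingLowerBoundAt W p` from `BSDp W p` for finite `Ш` (`missingLowerBoundAt_of_bsdp`);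
  hence **the K-6 statement AT `W` on the TOWER `λ`-road with NO descent certificate**:
  `missingLowerBoundAt_two_of_towerGap_of_layerSelmer` (odd torsion order; PRINT {modularity, GZK, Kato
  17.4 (1)(2)@2, Greenberg 4.1@2 as `hEC`, Greenberg Prop. 4.14@2} + CERT {`hper₀`, `TowerGapAtTwo W`,
  `2^n ≤ #Sel_{2^∞}(E/ℚ_j)[2]`, `λ_an = n`, `μ_an = 0`}, via tower-1/ord-2's
  `KatoHalfPinch.bsdp_two_of_towerGap_of_layerSelmer`) and its `E[2]`-irreducible form with `hper₀`
  discharged by Abbes–Ullmo and `hEC` by Greenberg 4.1 (`…_of_abbesUllmo`). This is the SECOND road to the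
  descent inequality on the open irreducible block (the first being a 2-power descent certificate read
  through `Typed.missingLowerBoundAt_two_of_shaAn_eq_16_of_dvd` / `…_64_of_dvd`).
* §3 (per curve, the trivial locus): if `#Ш_an(W) = q` with `ord_p q ≤ 0` the inequality holds outright
  (`missingLowerBoundAt_of_padicValRat_nonpos`) — the ∀-crux has content only where `p ∣ #Ш_an`.

CENSUS OF RECORD (evidence tier, not used here; CENSUS-19577.md on the item): on the 609 rank-`0`
good-ordinary X5 classes the inequality is certified by a 2-power descent record on ALL 609 — 563 at level
(2,2) (PARI `ellrank` + ENGINE CT-2), 11 by isogeny transport to such a member, and the 35 `#Ш_an = 64`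
classes at level (4,2) by the b2b-bsdres-sha-1 engines F (explicit 4-descent) + G (Cassels–Tate
`⟨x₄, y⟩ = 0` on `Sel₄ × Sel₂`, rows `gM = 0` of `X5/LevelRecordsG{,9}.lean`).

References: K. Kato, Astérisque 295 (2004), Thm. 17.4; R. Greenberg, LNM 1716 (1999), Thm. 4.1,
Prop. 4.14; A. Abbes, E. Ullmo, Compositio Math. 103 (1996), Thm. A; R. L. Miller, LMS J. Comput.
Math. 14 (2011), Def. 1.1.
-/

set_option autoImplicit false
-- the sub-problem namespace repeats the summit name by design (D-0017 nested layout)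
set_option linter.dupNamespace false

noncomputable section

open scoped Classical MatrixGroups ModularForm

open CongruenceSubgroup WeierstrassCurve Literature.NumberTheory.EllipticCurves
  Literature.NumberTheory.EllipticCurves.ModularForms Literature.NumberTheory.EllipticCurves.Rank1Residual
  Literature.NumberTheory.EllipticCurves.Rank1Residual.Typed
  Literature.NumberTheory.EllipticCurves.Greenberg1999
  Summit.BirchSwinnertonDyer.Rank1Residual.X1.MuLambda
  Summit.BirchSwinnertonDyer.Rank1Residual.X1.MuPart
  Summit.BirchSwinnertonDyer.Rank1Residual.X1.ParitySqueeze

namespace Summit.BirchSwinnertonDyer.BirchSwinnertonDyer.Theorems.EisensteinShaCurrency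

open Summit.BirchSwinnertonDyer.Rank1Residual Summit.BirchSwinnertonDyer.Rank1Residual.X5
  Summit.BirchSwinnertonDyer.Rank1Residual.X5.O1
  Summit.BirchSwinnertonDyer.BirchSwinnertonDyer.Theorems.Rank1ResidualX1Defs

/-! ## §2 Per-curve doors -/

section Curve

variable (W : WeierstrassCurve ℚ) [W.IsElliptic]

omit [W.IsElliptic] in
/-- **`BSD(E,p)` gives the descent inequality `ord_p #Ш_an ≤ ord_p #Ш`** when `Ш(E/ℚ)` is finite (then
`ord_p #Ш(p) = ord_p #Ш`). Bookkeeping on Miller's currency. [cite: Miller2011LMS, Def. 1.1 (arXiv:1010.2431 p. 3)] -/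
theorem missingLowerBoundAt_of_bsdp (p : ℕ) [Fact p.Prime] [Finite W.sha] (h : BSDp W p) :
    MissingLowerBoundAt W p :=
  (lower_and_upper_of_missingPPartAt W p (missingPPartAt_of_bsdp W p h)).1

omit [W.IsElliptic] in
/-- **The trivial locus of the descent crux:** if `#Ш_an(W)` is a rational `q` with `ord_p q ≤ 0` (e.g.
`p ∤ #Ш_an`), then `ord_p #Ш_an ≤ ord_p #Ш` holds outright (`ord_p` of a natural number is `≥ 0`).
So the ∀-crux `OrdMissingLowerBoundAtTwo` has content only on curves with `2 ∣ #Ш_an`.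
[cite: Miller2011LMS, Def. 1.1 (arXiv:1010.2431 p. 3)] -/
theorem missingLowerBoundAt_of_padicValRat_nonpos (p : ℕ) {q : ℚ} (hq : shaAn W = (q : ℂ))
    (hv : padicValRat p q ≤ 0) : MissingLowerBoundAt W p :=
  ⟨q, hq, hv.trans (by exact_mod_cast Nat.zero_le _)⟩

variable [W.IsGloballyMinimal]

/-- **The descent crux AT `W` on the TOWER `λ`-road — no descent certificate.** On a good-ordinary-at-`2`
curve of analytic rank `0` with ODD torsion order: PRINT {modularity `hmod`, GZK `hGZK`, Kato 17.4 (1)(2)@2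
`h17`, Greenberg Thm. 4.1@2 as `hEC`, Greenberg Prop. 4.14@2 `h414`} + CERTIFICATES {Néron integrality
`hper₀`, the tower gap `TowerGapAtTwo W` (`μ(X) = 0`), ONE layer count `2^n ≤ #Sel_{2^∞}(E/ℚ_j)[2]`,
`λ_an = n`, `μ_an = 0`} ⇒ `MissingLowerBoundAt W 2` — through `BSDp W 2`
(`KatoHalfPinch.bsdp_two_of_towerGap_of_layerSelmer`: `n ≤ λ(X)` from the layer count and Prop. 4.14,
then the `μ = 0` + `λ`-pinch) and the finiteness of `Ш` (GZK). The item `OrdMissingLowerBoundAtTwo` AT `W`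
is thereby met by the SAME finite-layer data that certify the Kato half, plus the analytic pair
`(λ_an, μ_an)`. [cite: GreenbergLNM1716, Thm. 4.1 (p. 102), Prop. 4.14 (§4)]
[cite: Kato2004Asterisque, Thm. 17.4 (1)(2) (p. 273)] [cite: Miller2011LMS, Def. 1.1] -/
theorem missingLowerBoundAt_two_of_towerGap_of_layerSelmer (hmod : nonempty_modularParametrizationData)
    (hGZK : rank_eq_analyticRank_of_analyticRank_le_one)
    (h17 : ∀ [NeZero (W.conductorNorm ℤ)] (f : CuspForm (Gamma0 (W.conductorNorm ℤ)) 2),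
      kato_divisibility_allPrimes W 2 (f := f))
    (hEC : TwoAdicEulerCharRankZero W 0) (h414 : prop414_noFiniteSubmodule_of_not_dvd_torsionOrder)
    (hper₀ : ∀ [NeZero (W.conductorNorm ℤ)] (f : CuspForm (Gamma0 (W.conductorNorm ℤ)) 2),
      IsNewformOf W f → ∀ ϖ : ℚ, (ϖ : ℝ) * W.realPeriodRat = plusPeriod f → 0 ≤ padicValRat 2 ϖ)
    (hgo : GoodOrd W 2) (hr : W.analyticRank = 0) (htors : ¬ 2 ∣ W.torsionOrder)
    (hgap : TowerGapAtTwo W) {j n : ℕ}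
    (hsel : ∀ κ : ZpExtension ℚ 2, κ.IsCyclotomic →
      2 ^ n ≤ Nat.card {z : W.selmerLayer κ j // 2 • z = 0})
    (hlan : AnalyticLambdaEq W 2 n) (hμan : AnalyticMuLE W 2 0) : MissingLowerBoundAt W 2 := by
  haveI : Finite W.sha := (hGZK W (by omega)).2
  exact missingLowerBoundAt_of_bsdp W 2
    (KatoHalfPinch.bsdp_two_of_towerGap_of_layerSelmer W hmod hGZK h17 hEC h414 hper₀ hgo hr htors hgap
      hsel hlan hμan)

/-- **The same on the `E[2]`-IRREDUCIBLE block, PRINT-only but for the certificates:** `hper₀` discharged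
by Abbes–Ullmo Thm. A (`hAU`, through `TowerClass.periodRatio_nonneg_of_irr_two_of_abbesUllmo`), `hEC` by
Greenberg Thm. 4.1@2 (`hGr`), odd torsion order by irreducibility. PRINT {`hmod`, `hGZK`, `h17`, `hGr`,
`h414`, `hAU`} + CERT {`GoodOrd W 2`, `Irr W 2`, `r_an = 0`, `TowerGapAtTwo W`, one layer count,
`λ_an = n`, `μ_an = 0`} ⇒ `MissingLowerBoundAt W 2`. [cite: AbbesUllmo1996, Thm. A]
[cite: GreenbergLNM1716, Thm. 4.1 (p. 102), Prop. 4.14 (§4)] [cite: Kato2004Asterisque, Thm. 17.4 (1)(2) (p. 273)] -/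
theorem missingLowerBoundAt_two_of_towerGap_of_layerSelmer_of_abbesUllmo
    (hmod : nonempty_modularParametrizationData) (hGZK : rank_eq_analyticRank_of_analyticRank_le_one)
    (h17 : ∀ [NeZero (W.conductorNorm ℤ)] (f : CuspForm (Gamma0 (W.conductorNorm ℤ)) 2),
      kato_divisibility_allPrimes W 2 (f := f))
    (hGr : Greenberg1999.thm41_charValue_rankZero_anyPrime)
    (h414 : prop414_noFiniteSubmodule_of_not_dvd_torsionOrder)
    (hAU : abbesUllmo_not_dvd_maninConstant_of_not_dvd_level) (hgo : GoodOrd W 2) (hirr : Irr W 2)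
    (hr : W.analyticRank = 0) (hgap : TowerGapAtTwo W) {j n : ℕ}
    (hsel : ∀ κ : ZpExtension ℚ 2, κ.IsCyclotomic →
      2 ^ n ≤ Nat.card {z : W.selmerLayer κ j // 2 • z = 0})
    (hlan : AnalyticLambdaEq W 2 n) (hμan : AnalyticMuLE W 2 0) : MissingLowerBoundAt W 2 :=
  missingLowerBoundAt_two_of_towerGap_of_layerSelmer W hmod hGZK h17
    (twoAdicEulerCharRankZero_zero_of_greenberg W hGr) h414
    (TowerClass.periodRatio_nonneg_of_irr_two_of_abbesUllmo W hAU hgo hirr) hgo hr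
    (TowerClass.not_two_dvd_torsionOrder_of_irr W hirr) hgap hsel hlan hμan

end Curve

/-! ## §1 The ∀-closed bookkeeping of the K-6 re-split -/

section Crux

/-- **K-6 is a weakening of the Eisenstein crux (given PUB).** Granted `OrdPublishedInputsAtTwo`
(modularity, GZK, Kato 17.4 (1)(2) AT `2`, Greenberg 4.1 parity-free), the ∀-closed Eisenstein half
`Theorems.OrdHalvesAtTwo.OrdEisensteinHalfAtTwo` (item 19272; = both route decls of that name) implies the
∀-closed descent inequality `Theorems.OrdHalvesAtTwo.OrdMissingLowerBoundAtTwo` (item 19577; = the K4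
route decl `Theses.ByReductionTypeAtTwo.OrdMissingLowerBoundAtTwo` by `Iff.rfl`): pointwise by the X5
door `O1.missingLowerBoundAt_two_of_eisenstein_of_kato`. The planner's Sketch-K6 term, landed.
[cite: Kato2004Asterisque, Thm. 17.4 (1)(2) (p. 273)] [cite: GreenbergLNM1716, Thm. 4.1 (p. 102)] -/
theorem ordMissingLowerBoundAtTwo_of_ordEisensteinHalfAtTwo
    (hpub : Literature.Uncategorized.OrdPublishedInputsAtTwo)
    (hE : Summit.BirchSwinnertonDyer.BirchSwinnertonDyer.Theorems.OrdHalvesAtTwo.OrdEisensteinHalfAtTwo) :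
    Summit.BirchSwinnertonDyer.BirchSwinnertonDyer.Theorems.OrdHalvesAtTwo.OrdMissingLowerBoundAtTwo := by
  obtain ⟨hmod, hGZK, h17, hGr⟩ := hpub
  intro W _ _ hcm hr hgo
  exact missingLowerBoundAt_two_of_eisenstein_of_kato W (twoAdicEulerCharRankZero_zero_of_greenberg W hGr)
    hmod hGZK (h17 W) hr hgo (hE W hcm hgo)

/-- **K-6 is necessary for the parent.** Granted GZK (finiteness of `Ш` at analytic rank `0`), the
unfolded parent `GoodOrdinaryRankZeroAtTwo` (`BSD(E,2)` for every non-CM, rank-`0`, good-ordinary-at-`2`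
globally minimal curve) implies `Theorems.OrdHalvesAtTwo.OrdMissingLowerBoundAtTwo` — so the re-split
`parent ⟸ PUB ∧ Kato half ∧ K-6` loses nothing on the descent side. [cite: Miller2011LMS, Def. 1.1] -/
theorem ordMissingLowerBoundAtTwo_of_forall_bsdp (hGZK : rank_eq_analyticRank_of_analyticRank_le_one)
    (hB : ∀ (W : WeierstrassCurve ℚ) [W.IsElliptic] [W.IsGloballyMinimal], ¬ W.HasCM →
      W.analyticRank = 0 → GoodOrd W 2 → BSDp W 2) :
    Summit.BirchSwinnertonDyer.BirchSwinnertonDyer.Theorems.OrdHalvesAtTwo.OrdMissingLowerBoundAtTwo := by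
  intro W _ _ hcm hr hgo
  haveI : Finite W.sha := (hGZK W (by omega)).2
  exact missingLowerBoundAt_of_bsdp W 2 (hB W hcm hr hgo)

end Crux

end Summit.BirchSwinnertonDyer.BirchSwinnertonDyer.Theorems.EisensteinShaCurrency

end
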